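import Mathlib.Analysis.SpecialFunctions.SmoothTransition
import HarnessLib

/-!
# Smooth modification of a function off a compact interval

Topic `Analysis/Calculus`; theorems only. If `g : ℝ → ℝ` is `Cⁿ` (`n ≤ ∞`) on an open interval
`(a, b)` and `a < lo ≤ hi < b`, there is a globally `Cⁿ` function `f : ℝ → ℝ` which agrees with
`g` on `[lo, hi]` and takes all its values among the values of `g` on a compact subinterval of
`(a, b)` (`Literature.Analysis.Calculus.exists_contDiff_eqOn_Icc`). Construction: `f = g ∘ φ` for
a smooth "squash" `φ : ℝ → [lo', hi'] ⊂ (a, b)` with `φ = id` on `[lo, hi]`, built from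
Mathlib's `Real.smoothTransition`. This is the routine device by which Itô's formula for `C²`
functions on the whole line (`Literature.Analysis.FunctionSpaces.ito_formula_itoProcess_ae`) is
applied to functions such as `u ↦ u^{1-4/κ}` on `(0, ∞)` or Lawler's hypergeometric `ψ` on
`(0, 1)` along a process stopped before it leaves a compact subinterval (Lawler (2005), proof of
Prop. 1.21: "Itô's formula shows that `M_t := φ₀(X_{t∧σ})` is a bounded martingale", `σ` the
exit time of `(x₁, x₂)`, `0 < x₁`).

## References

* G. F. Lawler, *Conformally Invariant Processes in the Plane* (2005), §1.10, proof of
  Prop. 1.21 (localisation to `[x₁, x₂]`).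
* Mathlib, `Real.smoothTransition` (a `C^∞` function equal to `0` on `(-∞, 0]` and to `1` on
  `[1, ∞)`).
-/

noncomputable section

open Set
open scoped ContDiff

namespace Literature.Analysis.Calculus

/-- **Lower smooth squash.** For `lo' < lo` there is a smooth `L : ℝ → ℝ` with `L x = x` for
`x ≥ lo` and `lo' ≤ L x ≤ max x lo` for all `x`
(`L x = lo' + (x - lo') S((x - lo')/(lo - lo'))`, `S` Mathlib's smooth transition). [folklore] -/
theorem exists_contDiff_lowerSquash {lo' lo : ℝ} (h : lo' < lo) :
    ∃ L : ℝ → ℝ, ContDiff ℝ ∞ L ∧ (∀ x, lo ≤ x → L x = x) ∧ (∀ x, lo' ≤ L x) ∧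
      ∀ x, L x ≤ max x lo := by
  have hd : 0 < lo - lo' := sub_pos.2 h
  set L : ℝ → ℝ := fun x ↦ lo' + (x - lo') * Real.smoothTransition ((x - lo') / (lo - lo'))
    with hL
  have hLx : ∀ x, L x = lo' + (x - lo') * Real.smoothTransition ((x - lo') / (lo - lo')) :=
    fun x ↦ rfl
  refine ⟨L, ?_, ?_, ?_, ?_⟩
  · refine contDiff_const.add ((contDiff_id.sub contDiff_const).mul ?_)
    exact Real.smoothTransition.contDiff.comp ((contDiff_id.sub contDiff_const).div_const _)
  · intro x hx
    have h1 : 1 ≤ (x - lo') / (lo - lo') := by rw [le_div_iff₀ hd]; linarith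
    rw [hLx, Real.smoothTransition.one_of_one_le h1]; ring
  · intro x
    rw [hLx]
    by_cases hx : lo' ≤ x
    · have := Real.smoothTransition.nonneg ((x - lo') / (lo - lo'))
      nlinarith
    · have h0 : (x - lo') / (lo - lo') ≤ 0 := div_nonpos_of_nonpos_of_nonneg (by linarith) hd.le
      rw [Real.smoothTransition.zero_of_nonpos h0]; linarith
  · intro x
    rw [hLx]
    by_cases hx : lo ≤ x
    · have h1 : 1 ≤ (x - lo') / (lo - lo') := by rw [le_div_iff₀ hd]; linarith
      rw [Real.smoothTransition.one_of_one_le h1]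
      simp
    · rw [not_le] at hx
      by_cases hx' : lo' ≤ x
      · have h2 := Real.smoothTransition.le_one ((x - lo') / (lo - lo'))
        have h3 : lo' + (x - lo') * Real.smoothTransition ((x - lo') / (lo - lo')) ≤ x := by
          nlinarith
        exact h3.trans (le_max_left _ _)
      · have h0 : (x - lo') / (lo - lo') ≤ 0 :=
          div_nonpos_of_nonpos_of_nonneg (by linarith) hd.le
        rw [Real.smoothTransition.zero_of_nonpos h0, mul_zero, add_zero]
        exact h.le.trans (le_max_right _ _)

/-- **Upper smooth squash.** For `hi < hi'` there is a smooth `U : ℝ → ℝ` with `U x = x` for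
`x ≤ hi` and `min x hi ≤ U x ≤ hi'` for all `x` (reflection of the lower squash). [folklore] -/
theorem exists_contDiff_upperSquash {hi hi' : ℝ} (h : hi < hi') :
    ∃ U : ℝ → ℝ, ContDiff ℝ ∞ U ∧ (∀ x, x ≤ hi → U x = x) ∧ (∀ x, U x ≤ hi') ∧
      ∀ x, min x hi ≤ U x := by
  obtain ⟨L, hL, hLid, hLlo, hLle⟩ := exists_contDiff_lowerSquash (neg_lt_neg h)
  refine ⟨fun x ↦ -L (-x), (hL.comp contDiff_neg).neg, fun x hx ↦ ?_, fun x ↦ ?_, fun x ↦ ?_⟩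
  · show -L (-x) = x
    rw [hLid (-x) (neg_le_neg hx), neg_neg]
  · show -L (-x) ≤ hi'
    have := hLlo (-x); linarith
  · show min x hi ≤ -L (-x)
    have h1 := hLle (-x)
    rcases le_total x hi with hx | hx
    · rw [min_eq_left hx]
      have : max (-x) (-hi) = -x := max_eq_left (neg_le_neg hx)
      rw [this] at h1; linarith
    · rw [min_eq_right hx]
      have : max (-x) (-hi) = -hi := max_eq_right (neg_le_neg hx)
      rw [this] at h1; linarith

/-- **Smooth squash onto a compact subinterval.** For `lo' < lo ≤ hi < hi'` there is a smooth
`φ : ℝ → ℝ` with `φ x = x` on `[lo, hi]` and `φ x ∈ [lo', hi']` for every `x`. [folklore] -/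
theorem exists_contDiff_squash {lo' lo hi hi' : ℝ} (hlo : lo' < lo) (hlh : lo ≤ hi)
    (hhi : hi < hi') :
    ∃ φ : ℝ → ℝ, ContDiff ℝ ∞ φ ∧ (∀ x ∈ Icc lo hi, φ x = x) ∧ ∀ x, φ x ∈ Icc lo' hi' := by
  obtain ⟨L, hL, hLid, hLlo, hLle⟩ := exists_contDiff_lowerSquash hlo
  obtain ⟨U, hU, hUid, hUhi, -⟩ := exists_contDiff_upperSquash hhi
  refine ⟨L ∘ U, hL.comp hU, fun x hx ↦ ?_, fun x ↦ ⟨hLlo _, ?_⟩⟩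
  · simp only [Function.comp_apply, hUid x hx.2, hLid x hx.1]
  · simp only [Function.comp_apply]
    exact (hLle (U x)).trans (max_le (hUhi x) (hlh.trans hhi.le))

/-- **Smooth modification off a compact interval.** Let `g : ℝ → ℝ` be `Cⁿ` (`n : ℕ∞`) on the
open interval `(a, b)` and `a < lo ≤ hi < b`. Then there is `f : ℝ → ℝ`, `Cⁿ` on all of `ℝ`, with
`f = g` on `[lo, hi]`, and every value `f x` is a value `g y` with
`y ∈ [(a + lo)/2, (hi + b)/2] ⊂ (a, b)` (so bounds for `g` on that compact interval transfer to
`f`). Proof: `f = g ∘ φ` with the smooth squash `φ` of `exists_contDiff_squash`.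
Used to feed Itô's formula for globally `C²` functions with functions that are only `C²` on an
open interval, along processes stopped inside a compact subinterval (Lawler (2005), proof of
Prop. 1.21). [folklore] -/
theorem exists_contDiff_eqOn_Icc {n : ℕ∞} {g : ℝ → ℝ} {a b lo hi : ℝ} (ha : a < lo)
    (hlh : lo ≤ hi) (hb : hi < b) (hg : ContDiffOn ℝ n g (Ioo a b)) :
    ∃ f : ℝ → ℝ, ContDiff ℝ n f ∧ EqOn f g (Icc lo hi) ∧
      ∀ x, ∃ y ∈ Icc ((a + lo) / 2) ((hi + b) / 2), f x = g y := by
  obtain ⟨φ, hφ, hφid, hφmem⟩ := exists_contDiff_squash (lo' := (a + lo) / 2)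
    (hi' := (hi + b) / 2) (by linarith) hlh (by linarith)
  have hmaps : ∀ x, φ x ∈ Ioo a b := fun x ↦
    ⟨by linarith [(hφmem x).1], by linarith [(hφmem x).2]⟩
  have hφn : ContDiff ℝ n φ := hφ.of_le (by exact_mod_cast le_top)
  refine ⟨g ∘ φ, hg.comp_contDiff hφn hmaps, fun x hx ↦ ?_, fun x ↦ ⟨φ x, hφmem x, rfl⟩⟩
  simp only [Function.comp_apply, hφid x hx]

end Literature.Analysis.Calculus
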